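import Mathlib.NumberTheory.LSeries.PrimesInAP
import Literature.NumberTheory.LFunctions.VonMangoldtLaplace
import HarnessLib

/-!
# The Laplace series `∑_{n ≡ a (q)} Λ(n) e^{-nt}`: Mellin transform and a Landau step under DZC

Support file (everything PROVED, no definitions, no named facts) for the arithmetic-progression
analogue of the Bhowmik–Ruzsa / Granville equivalence between power savings in the averaged
Goldbach problem and zero-free half-planes: G. Bhowmik, K. Halupczok, K. Matsumoto, Y. Suzuki,
*Goldbach representations in arithmetic progressions and zeros of Dirichlet L-functions*,
Mathematika 65 (2019), 57–97 (arXiv:1704.06103), Theorem 1 (2) — the tree's named fact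
`Literature.Barriers.Parity.BHMS2019_thm1_ii` (`Literature/Barriers/Parity/GoldbachAverageZeros.lean`),
discharged in `Literature/Barriers/Parity/GoldbachAverageZerosProofs.lean`. The printed proof runs
through an explicit formula for `S(x; q, a, b)` (their Theorem 2) and the meromorphic continuation
of `∑ G(n; q, a, b) n^{-s}` (Proposition 3); here, as in the tree's treatment of the case `q = 1`
(`Literature/NumberTheory/LFunctions/VonMangoldtLaplace.lean`), the generating function is taken on
the positive real axis (`z = e^{-t}`) and continued through its Mellin transform, which for a
residue class is `Γ(s)` times a combination of the `L'/L(s, χ)`.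

* `coeff_eq_zero_of_sum_logDeriv` — abstract Landau step: if `g = −∑ cᵢ fᵢ'/fᵢ` on an open
  subset of a preconnected open `U` (all functions holomorphic on `U`) and `w₀ ∈ U` is a zero of
  `f_{i₀}` alone, then `c_{i₀} = 0` (identity theorem applied to
  `g ∏ fᵢ + ∑ cᵢ fᵢ' ∏_{j ≠ i} fⱼ`, then the local lemma
  `Literature.NumberTheory.LFunctions.VonKochConverse.eventuallyEq_zero_of_deriv_eq_mul`).
* `coeff_eq_zero_of_LFunction_eq_zero` — the Dirichlet-character instance under the Distinct Zero
  Conjecture (DZC) mod `q`: if `M` is holomorphic on `Re s > θ > 0` and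
  `M = Γ · (−∑_χ c_χ L'/L(·,χ) − c₁/(s−1))` far to the right, then `c_{χ₁} = 0` at every zero
  `ρ` of `L(·,χ₁)` with `θ < Re ρ < 1`, `ρ ≠ 1/2` (the entire functions are `L(·,χ)`, `χ ≠ 1`, and
  Mathlib's `LFunctionTrivChar₁ q = (s−1)L(s,1)`).
* `E_a(t) = ∑_{n ≡ a} Λ(n)e^{-nt} − e^{-t}/(φ(q)t)` (written out; `∑_{n ≡ a} Λ(n)e^{-nt}` is
  `laplaceSeries (ArithmeticFunction.vonMangoldt.residueClass a)`): continuity, `O(e^{-t})` at `∞`,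
  `O(t^{-2})` at `0⁺`, Mellin convergence on `Re s > 2`, and
  `mellin_errLaplace`: `∫₀^∞ E_a(t)t^{s−1}dt = Γ(s) · LFunctionResidueClassAux a s`
  (`= Γ(s)(L(Λ_a,s) − φ⁻¹/(s−1)) = Γ(s)(−φ⁻¹∑_χ χ(a)⁻¹L'/L(s,χ) − φ⁻¹/(s−1))`, Mathlib
  `ArithmeticFunction.vonMangoldt.LSeries_residueClass_eq`).
* `apply_inv_add_apply_inv_eq_zero` — **the Landau step for `E_a + E_b`**: under DZC, if
  `E_a + E_b = O(t^{-θ})` at `0⁺` then `χ₁(a)⁻¹ + χ₁(b)⁻¹ = 0` at every zero of `L(·,χ₁)` with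
  `θ < Re ρ < 1`, `ρ ≠ 1/2`. This replaces Bhowmik–Halupczok–Matsumoto–Suzuki's Proposition 3
  ("by DZC … this residue is non-zero so that `ρ_q + 1` is a pole of `F(s)`").

## References

* G. Bhowmik, K. Halupczok, K. Matsumoto, Y. Suzuki, Mathematika 65 (2019), 57–97,
  arXiv:1704.06103: Theorem 1, Proposition 3 and §7 (proof of Theorem 1 (2)), §8.
* G. Bhowmik, I. Z. Ruzsa, *Average Goldbach and the quasi-Riemann hypothesis*, Anal. Math. 44
  (2018), 51–56 (the power-series method).
* H. L. Montgomery, R. C. Vaughan, *Multiplicative Number Theory I*, CUP 2007, §15.1 (the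
  analytic-continuation argument).
-/

noncomputable section

open Filter Asymptotics MeasureTheory Set Complex Finset
open scoped Topology

namespace Literature.NumberTheory.LFunctions

namespace LaplaceProgressions

/-- **Abstract Landau step for a combination of logarithmic derivatives.** Let `f i` (`i ∈ ι`,
finite) and `g` be holomorphic on a preconnected open set `U`, and suppose
`g = -∑ cᵢ fᵢ'/fᵢ` on an open `V ⊆ U` (non-empty) on which no `fᵢ` vanishes. If `w₀ ∈ U` is a zero
of `f i₀` but of no other `fᵢ`, and `f i₀` does not vanish identically on `U`, then `c i₀ = 0`:
otherwise `Φ = g ∏ fᵢ + ∑ cᵢ fᵢ' ∏_{j ≠ i} fⱼ` vanishes on `V`, hence on `U`, which near `w₀` reads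
`f_{i₀}' = h · f_{i₀}` with `h` continuous, forcing `f_{i₀} ≡ 0` near `w₀`. [folklore] -/
theorem coeff_eq_zero_of_sum_logDeriv {ι : Type*} [Fintype ι] [DecidableEq ι]
    {U V : Set ℂ} (hU : IsOpen U) (hUc : IsPreconnected U) (hV : IsOpen V) (hVU : V ⊆ U)
    {f : ι → ℂ → ℂ} (hf : ∀ i, DifferentiableOn ℂ (f i) U) {g : ℂ → ℂ}
    (hg : DifferentiableOn ℂ g U) (c : ι → ℂ) (hfV : ∀ i, ∀ w ∈ V, f i w ≠ 0)
    (hgV : ∀ w ∈ V, g w = -∑ i, c i * (deriv (f i) w / f i w)) {z₁ : ℂ} (hz₁ : z₁ ∈ V)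
    {i₀ : ι} {w₀ : ℂ} (hw₀ : w₀ ∈ U) (h0 : f i₀ w₀ = 0) (hne : ∀ i, i ≠ i₀ → f i w₀ ≠ 0)
    {z₂ : ℂ} (hz₂ : z₂ ∈ U) (hfz₂ : f i₀ z₂ ≠ 0) :
    c i₀ = 0 := by
  by_contra hc
  set Φ : ℂ → ℂ := fun w ↦ g w * ∏ i, f i w +
    ∑ i, c i * (deriv (f i) w * ∏ j ∈ univ.erase i, f j w) with hΦdef
  have hfd : ∀ i, ∀ w ∈ U, DifferentiableAt ℂ (f i) w := fun i w hw ↦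
    (hf i).differentiableAt (hU.mem_nhds hw)
  have hfd' : ∀ i, ∀ w ∈ U, DifferentiableAt ℂ (deriv (f i)) w := fun i w hw ↦
    (((hf i).analyticOnNhd hU).deriv w hw).differentiableAt
  -- `Φ` is analytic on `U`
  have hΦan : AnalyticOnNhd ℂ Φ U := by
    refine DifferentiableOn.analyticOnNhd (fun w hw ↦ ?_) hU
    have hgw : DifferentiableAt ℂ g w := hg.differentiableAt (hU.mem_nhds hw)
    have h1 : DifferentiableAt ℂ (fun w ↦ ∏ i, f i w) w :=
      DifferentiableAt.fun_finsetProd fun i _ ↦ hfd i w hw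
    have h2 : DifferentiableAt ℂ
        (fun w ↦ ∑ i, c i * (deriv (f i) w * ∏ j ∈ univ.erase i, f j w)) w := by
      refine DifferentiableAt.fun_sum fun i _ ↦ ?_
      refine (differentiableAt_const _).mul ((hfd' i w hw).mul ?_)
      exact DifferentiableAt.fun_finsetProd fun j _ ↦ hfd j w hw
    exact ((hgw.mul h1).add h2).differentiableWithinAt
  -- `Φ = 0` on `V`
  have hΦV : ∀ w ∈ V, Φ w = 0 := by
    intro w hw
    have hPi : ∀ i, deriv (f i) w * ∏ j ∈ univ.erase i, f j w =
        (deriv (f i) w / f i w) * ∏ j, f j w := by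
      intro i
      rw [← Finset.mul_prod_erase univ (fun j ↦ f j w) (Finset.mem_univ i)]
      field_simp [hfV i w hw]
    simp only [hΦdef, hgV w hw, hPi]
    rw [neg_mul, Finset.sum_mul]
    simp_rw [mul_assoc]
    exact neg_add_cancel _
  have hΦ0 : Φ =ᶠ[𝓝 z₁] 0 :=
    Filter.eventuallyEq_of_mem (hV.mem_nhds hz₁) fun w hw ↦ hΦV w hw
  have hΦU : EqOn Φ 0 U := hΦan.eqOn_zero_of_preconnected_of_eventuallyEq_zero hUc (hVU hz₁) hΦ0
  -- the factorisation `Φ = f i₀ · A + c i₀ f i₀' P`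
  set P : ℂ → ℂ := fun w ↦ ∏ j ∈ univ.erase i₀, f j w with hPdef
  set A : ℂ → ℂ := fun w ↦ g w * P w +
    ∑ i ∈ univ.erase i₀, c i * (deriv (f i) w * ∏ j ∈ (univ.erase i).erase i₀, f j w) with hAdef
  have hΦeq : ∀ w, Φ w = f i₀ w * A w + c i₀ * (deriv (f i₀) w * P w) := by
    intro w
    have h1 : ∏ i, f i w = f i₀ w * P w :=
      (Finset.mul_prod_erase univ (fun j ↦ f j w) (Finset.mem_univ i₀)).symm
    have h2 : ∑ i ∈ univ.erase i₀, c i * (deriv (f i) w * ∏ j ∈ univ.erase i, f j w) =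
        f i₀ w * ∑ i ∈ univ.erase i₀,
          c i * (deriv (f i) w * ∏ j ∈ (univ.erase i).erase i₀, f j w) := by
      rw [Finset.mul_sum]
      refine Finset.sum_congr rfl fun i hi ↦ ?_
      have : i₀ ∈ univ.erase i :=
        Finset.mem_erase.mpr ⟨(Finset.ne_of_mem_erase hi).symm, mem_univ _⟩
      rw [← Finset.mul_prod_erase _ (fun j ↦ f j w) this]
      ring
    have h3 : ∑ i, c i * (deriv (f i) w * ∏ j ∈ univ.erase i, f j w) =
        c i₀ * (deriv (f i₀) w * P w) +
          ∑ i ∈ univ.erase i₀, c i * (deriv (f i) w * ∏ j ∈ univ.erase i, f j w) :=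
      (Finset.add_sum_erase univ _ (Finset.mem_univ i₀)).symm
    simp only [hΦdef, hAdef]
    rw [h1, h3, h2]
    ring
  -- continuity of `A`, `P` at `w₀` and `P w₀ ≠ 0`
  have hP0 : P w₀ ≠ 0 :=
    Finset.prod_ne_zero_iff.mpr fun j hj ↦ hne j (Finset.ne_of_mem_erase hj)
  have hPd : DifferentiableAt ℂ P w₀ := DifferentiableAt.fun_finsetProd fun j _ ↦ hfd j w₀ hw₀
  have hAd : DifferentiableAt ℂ A w₀ := by
    have hgw : DifferentiableAt ℂ g w₀ := hg.differentiableAt (hU.mem_nhds hw₀)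
    refine (hgw.mul hPd).add (DifferentiableAt.fun_sum fun i _ ↦ ?_)
    refine (differentiableAt_const _).mul ((hfd' i w₀ hw₀).mul ?_)
    exact DifferentiableAt.fun_finsetProd fun j _ ↦ hfd j w₀ hw₀
  have hloc : ∀ᶠ w in 𝓝 w₀, deriv (f i₀) w = (-(A w) / (c i₀ * P w)) * f i₀ w := by
    filter_upwards [hU.mem_nhds hw₀,
      hPd.continuousAt.preimage_mem_nhds (isOpen_ne.mem_nhds hP0)] with w hwU hPw
    have hPw : P w ≠ 0 := hPw
    have h := hΦU hwU
    rw [Pi.zero_apply, hΦeq] at h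
    field_simp
    linear_combination h
  have hcont : ContinuousAt (fun w ↦ -(A w) / (c i₀ * P w)) w₀ :=
    (hAd.neg.div ((differentiableAt_const _).mul hPd) (mul_ne_zero hc hP0)).continuousAt
  have hzero := VonKochConverse.eventuallyEq_zero_of_deriv_eq_mul
    (((hf i₀).analyticOnNhd hU) w₀ hw₀) hcont hloc h0
  have hall := ((hf i₀).analyticOnNhd hU).eqOn_zero_of_preconnected_of_eventuallyEq_zero hUc hw₀
    hzero
  exact hfz₂ (hall hz₂)

/-! ### The Landau step for Dirichlet characters under the Distinct Zero Conjecture -/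

open DirichletCharacter in
/-- **Landau-type lemma for combinations of `L'/L` under DZC.** Let `M` be holomorphic on
`Re w > θ` (`0 < θ`) and suppose that on some half-plane `Re w > σ₁` (`σ₁ ≥ 1`)
`M(w) = Γ(w) · (−∑_χ c_χ L'(w,χ)/L(w,χ) − c₁/(w−1))` (sum over the Dirichlet characters mod `q`,
`c₁` the coefficient of the principal character). Assume the Distinct Zero Conjecture mod `q`
(two distinct `L(·,χ)` have no common zero in `0 < Re s < 1` except possibly `s = 1/2`). Then
every zero `ρ` of some `L(·,χ₁)` with `θ < Re ρ < 1`, `ρ ≠ 1/2`, has `c_{χ₁} = 0`: with the entire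
functions `f_χ = L(·,χ)` (`χ ≠ 1`), `f₁ = (w−1)L(w,1)` (Mathlib's `LFunctionTrivChar₁`) one has
`M/Γ = −∑ c_χ f_χ'/f_χ` on `Re w > σ₁`, and `coeff_eq_zero_of_sum_logDeriv` applies on the
half-plane `Re w > θ`, `ρ` being a zero of `f_{χ₁}` alone (DZC). This is the mechanism of
Bhowmik–Halupczok–Matsumoto–Suzuki's Proposition 3 / proof of Theorem 1 (2) ("by DZC … this
residue is non-zero so that `ρ_q + 1` is a pole"), run on the Mellin side.
[cite: BhowmikHalupczokMatsumotoSuzuki2019, Proposition 3 and proof of Theorem 1 (2)] -/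
theorem coeff_eq_zero_of_LFunction_eq_zero {q : ℕ} [NeZero q]
    (hDZC : ∀ χ₁ χ₂ : DirichletCharacter ℂ q, χ₁ ≠ χ₂ →
      ∀ s : ℂ, 0 < s.re → s.re < 1 → s ≠ 1 / 2 → ¬ (χ₁.LFunction s = 0 ∧ χ₂.LFunction s = 0))
    {θ : ℝ} (hθ0 : 0 < θ) {M : ℂ → ℂ}
    (hM : ∀ w : ℂ, θ < w.re → DifferentiableAt ℂ M w) (c : DirichletCharacter ℂ q → ℂ)
    {σ₁ : ℝ} (hσ₁ : 1 ≤ σ₁)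
    (hid : ∀ w : ℂ, σ₁ < w.re → M w = Complex.Gamma w *
      (-(∑ χ, c χ * (deriv χ.LFunction w / χ.LFunction w)) - c 1 / (w - 1)))
    {χ₁ : DirichletCharacter ℂ q} {ρ : ℂ} (hρ : χ₁.LFunction ρ = 0) (h1 : θ < ρ.re)
    (h2 : ρ.re < 1) (h3 : ρ ≠ 1 / 2) : c χ₁ = 0 := by
  classical
  have hρ0 : 0 < ρ.re := hθ0.trans h1
  have hρ1 : ρ ≠ 1 := fun h ↦ by simp [h] at h2
  -- the entire functions `f_χ`
  set F : DirichletCharacter ℂ q → ℂ → ℂ :=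
    Function.update (fun χ ↦ χ.LFunction) 1 (LFunctionTrivChar₁ q) with hF
  have hF1 : F 1 = LFunctionTrivChar₁ q := Function.update_self ..
  have hFne : ∀ χ, χ ≠ 1 → F χ = χ.LFunction := fun χ hχ ↦ Function.update_of_ne hχ ..
  have hF1_apply : ∀ w : ℂ, w ≠ 1 → F 1 w = (w - 1) * LFunctionTrivChar q w := by
    intro w hw
    rw [hF1, LFunctionTrivChar₁, Function.update_of_ne hw]
  have hFd : ∀ χ, Differentiable ℂ (F χ) := by
    intro χ
    rcases eq_or_ne χ 1 with rfl | hχ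
    · rw [hF1]; exact differentiable_LFunctionTrivChar₁ q
    · rw [hFne χ hχ]; exact differentiable_LFunction hχ
  -- the sets `U ⊇ V`
  set U : Set ℂ := {w | θ < w.re} with hU
  set V : Set ℂ := {w | σ₁ < w.re} with hV
  have hUo : IsOpen U := isOpen_lt continuous_const continuous_re
  have hVo : IsOpen V := isOpen_lt continuous_const continuous_re
  have hVU : V ⊆ U := fun w (hw : σ₁ < w.re) ↦ show θ < w.re by linarith [h1, h2]
  have hUc : IsPreconnected U := (convex_halfSpace_re_gt θ).isPreconnected
  -- `Γ` on `U`
  have hΓd : ∀ w ∈ U, DifferentiableAt ℂ Complex.Gamma w := by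
    intro w hw
    refine Complex.differentiableAt_Gamma w fun m hm ↦ ?_
    have : θ < w.re := hw
    rw [hm] at this
    simp at this
    linarith [(m.cast_nonneg : (0 : ℝ) ≤ m)]
  have hΓ0 : ∀ w ∈ U, Complex.Gamma w ≠ 0 := fun w hw ↦
    Complex.Gamma_ne_zero_of_re_pos (hθ0.trans hw)
  -- `g = M/Γ`
  set g : ℂ → ℂ := fun w ↦ M w / Complex.Gamma w with hg
  have hgd : DifferentiableOn ℂ g U := fun w hw ↦
    ((hM w hw).div (hΓd w hw) (hΓ0 w hw)).differentiableWithinAt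
  -- no `f_χ` vanishes on `V`
  have hFV : ∀ χ, ∀ w ∈ V, F χ w ≠ 0 := by
    intro χ w hw
    have hw : 1 < w.re := lt_of_le_of_lt hσ₁ hw
    have hw1 : w ≠ 1 := fun h ↦ by simp [h] at hw
    rcases eq_or_ne χ 1 with rfl | hχ
    · rw [hF1_apply w hw1]
      exact mul_ne_zero (sub_ne_zero.mpr hw1)
        (LFunction_ne_zero_of_one_le_re 1 (.inr hw1) hw.le)
    · rw [hFne χ hχ]
      exact LFunction_ne_zero_of_one_le_re χ (.inl hχ) hw.le
  -- `g = -∑ c_χ f_χ'/f_χ` on `V`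
  have hgV : ∀ w ∈ V, g w = -∑ χ, c χ * (deriv (F χ) w / F χ w) := by
    intro w hw'
    have hw : 1 < w.re := lt_of_le_of_lt hσ₁ hw'
    have hw1 : w ≠ 1 := fun h ↦ by simp [h] at hw
    have hL1 : LFunctionTrivChar q w ≠ 0 := LFunction_ne_zero_of_one_le_re 1 (.inr hw1) hw.le
    have hsplit : ∑ χ, c χ * (deriv (F χ) w / F χ w) =
        ∑ χ, c χ * (deriv χ.LFunction w / χ.LFunction w) + c 1 / (w - 1) := by
      rw [Fintype.sum_eq_add_sum_compl 1, Fintype.sum_eq_add_sum_compl 1, add_assoc,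
        add_comm _ (c 1 / (w - 1)), ← add_assoc]
      congr 1
      · rw [hF1, deriv_LFunctionTrivChar₁_apply_of_ne_one q hw1, LFunctionTrivChar₁,
          Function.update_of_ne hw1]
        have hw1' : (w - 1) ≠ 0 := sub_ne_zero.mpr hw1
        field_simp
      · refine Finset.sum_congr rfl fun χ hχ ↦ ?_
        have hχ : χ ≠ 1 := by simpa using hχ
        rw [hFne χ hχ]
    have hΓ : Complex.Gamma w ≠ 0 := hΓ0 w (hVU hw')
    simp only [hg, hid w hw', hsplit]
    field_simp
    ring
  -- `ρ` is a zero of `f_{χ₁}` and of no other `f_χ`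
  have hρU : ρ ∈ U := h1
  have h0 : F χ₁ ρ = 0 := by
    rcases eq_or_ne χ₁ 1 with rfl | hχ
    · rw [hF1_apply ρ hρ1, show LFunctionTrivChar q ρ = 0 from hρ, mul_zero]
    · rw [hFne χ₁ hχ, hρ]
  have hne : ∀ χ, χ ≠ χ₁ → F χ ρ ≠ 0 := by
    intro χ hχ
    have key : χ.LFunction ρ ≠ 0 := fun h ↦ hDZC χ χ₁ hχ ρ hρ0 h2 h3 ⟨h, hρ⟩
    rcases eq_or_ne χ 1 with rfl | hχ1
    · rw [hF1_apply ρ hρ1]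
      exact mul_ne_zero (sub_ne_zero.mpr hρ1) key
    · rwa [hFne χ hχ1]
  have h2V : ((σ₁ + 1 : ℝ) : ℂ) ∈ V := by simp [hV]
  exact coeff_eq_zero_of_sum_logDeriv hUo hUc hVo hVU (fun χ ↦ (hFd χ).differentiableOn) hgd c
    hFV hgV h2V hρU h0 hne (hVU h2V) (hFV χ₁ _ h2V)

/-! ### The Laplace series of `Λ` on a residue class: `E_a(t) = ∑_{n ≡ a} Λ(n)e^{-nt} − e^{-t}/(φ(q)t)` -/

section ResidueClass

open ArithmeticFunction ArithmeticFunction.vonMangoldt DirichletCharacter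
open scoped ArithmeticFunction.vonMangoldt LSeries.notation

variable {q : ℕ} [NeZero q]

omit [NeZero q] in
/-- `0 ≤ Λ_a(n) ≤ n + 1` for the von Mangoldt function restricted to a residue class
(`Λ_a = ArithmeticFunction.vonMangoldt.residueClass a`). [folklore] -/
theorem residueClass_nonneg_le (a : ZMod q) (n : ℕ) :
    0 ≤ residueClass a n ∧ residueClass a n ≤ (n : ℝ) + 1 :=
  ⟨residueClass_nonneg a n, (residueClass_le a n).trans (vonMangoldt_nonneg_le n).2⟩

omit [NeZero q] in
/-- `|Λ_a(n)| ≤ n + 1`. [folklore] -/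
theorem abs_residueClass_le (a : ZMod q) (n : ℕ) : |residueClass a n| ≤ (n : ℝ) + 1 := by
  rw [abs_of_nonneg (residueClass_nonneg a n)]
  exact (residueClass_nonneg_le a n).2

omit [NeZero q] in
/-- `|Λ_a(n)| ≤ 1 · (n + 1)^1`. [folklore] -/
theorem abs_residueClass_le' (a : ZMod q) (n : ℕ) :
    |residueClass a n| ≤ 1 * ((n : ℝ) + 1) ^ 1 := by
  rw [one_mul, pow_one]; exact abs_residueClass_le a n

omit [NeZero q] in
/-- The Laplace series `F_a(t) = ∑_{n ≡ a (q)} Λ(n) e^{-nt}` is dominated by `∑ (n+1) e^{-nt}`: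
crudely `0 ≤ F_a(t) ≤ K t^{-2}` for `0 < t ≤ 1`. [folklore] -/
theorem laplaceSeries_residueClass_le (a : ZMod q) {t : ℝ} (ht : 0 < t) (ht1 : t ≤ 1) :
    0 ≤ laplaceSeries (residueClass a) t ∧
      laplaceSeries (residueClass a) t ≤ geomWeightConst 1 * t ^ (-(2 : ℝ)) := by
  refine ⟨laplaceSeries_nonneg (fun n ↦ residueClass_nonneg a n) t, ?_⟩
  obtain ⟨hS, hle⟩ := tsum_pow_succ_rpow_mul_exp_le zero_le_one ht ht1
  rw [show (-(1 + 1) : ℝ) = -2 by norm_num] at hle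
  refine le_trans ?_ hle
  rw [laplaceSeries_def]
  refine Summable.tsum_le_tsum (fun n ↦ ?_)
    (summable_abs_mul_exp_of_le (abs_residueClass_le' a) ht).of_norm hS
  rw [Real.rpow_one]
  exact mul_le_mul_of_nonneg_right (residueClass_nonneg_le a n).2 (Real.exp_pos _).le

/-- `E_a(t) = F_a(t) − e^{-t}/(φ(q) t)` is continuous on `(0, ∞)`. [folklore] -/
theorem continuousOn_errLaplace (a : ZMod q) :
    ContinuousOn (fun t : ℝ ↦ laplaceSeries (residueClass a) t -
      Real.exp (-t) / ((q.totient : ℝ) * t)) (Ioi 0) := by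
  refine (continuousOn_laplaceSeries (abs_residueClass_le a)).sub ?_
  refine ContinuousOn.div (by fun_prop) (by fun_prop) fun t ht ↦ ?_
  have ht : (0 : ℝ) < t := ht
  have hφ : (0 : ℝ) < q.totient := by exact_mod_cast Nat.totient_pos.mpr (NeZero.pos q)
  positivity

/-- `E_a(t) = O(e^{-t})` as `t → ∞`. [folklore] -/
theorem errLaplace_isBigO_exp_atTop (a : ZMod q) :
    (fun t : ℝ ↦ ((laplaceSeries (residueClass a) t -
      Real.exp (-t) / ((q.totient : ℝ) * t) : ℝ) : ℂ)) =O[atTop] fun t ↦ Real.exp (-1 * t) := by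
  obtain ⟨C, hC⟩ := exists_abs_laplaceSeries_le_exp_neg (residueClass_apply_zero a)
    (abs_residueClass_le a)
  have hφ : (1 : ℝ) ≤ q.totient := by exact_mod_cast Nat.totient_pos.mpr (NeZero.pos q)
  refine IsBigO.of_bound (C + 1) ?_
  filter_upwards [eventually_ge_atTop 1] with t ht
  have ht0 : 0 < t := by linarith
  rw [Complex.norm_real, Real.norm_eq_abs, Real.norm_eq_abs, abs_of_pos (Real.exp_pos _),
    neg_one_mul]
  have h1 := hC t ht
  have h2 : |Real.exp (-t) / ((q.totient : ℝ) * t)| ≤ Real.exp (-t) := by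
    rw [abs_of_nonneg (by positivity), div_le_iff₀ (by positivity)]
    have : (1 : ℝ) ≤ (q.totient : ℝ) * t := by nlinarith
    nlinarith [Real.exp_pos (-t)]
  calc |laplaceSeries (residueClass a) t - Real.exp (-t) / ((q.totient : ℝ) * t)|
      ≤ |laplaceSeries (residueClass a) t| + |Real.exp (-t) / ((q.totient : ℝ) * t)| :=
        abs_sub _ _
    _ ≤ C * Real.exp (-t) + Real.exp (-t) := add_le_add h1 h2
    _ = (C + 1) * Real.exp (-t) := by ring

/-- Crude behaviour at `0⁺`: `E_a(t) = O(t^{-2})`. [folklore] -/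
theorem errLaplace_isBigO_nhdsGT_two (a : ZMod q) :
    (fun t : ℝ ↦ ((laplaceSeries (residueClass a) t -
      Real.exp (-t) / ((q.totient : ℝ) * t) : ℝ) : ℂ)) =O[𝓝[>] 0] fun t ↦ t ^ (-(2 : ℝ)) := by
  have hφ : (1 : ℝ) ≤ q.totient := by exact_mod_cast Nat.totient_pos.mpr (NeZero.pos q)
  refine IsBigO.of_bound (geomWeightConst 1 + 1) ?_
  filter_upwards [Ioo_mem_nhdsGT one_pos] with t ht
  have ht0 : 0 < t := ht.1
  obtain ⟨h0, hle⟩ := laplaceSeries_residueClass_le a ht.1 ht.2.le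
  have htpow : 0 < t ^ (-(2 : ℝ)) := Real.rpow_pos_of_pos ht.1 _
  rw [Complex.norm_real, Real.norm_eq_abs, Real.norm_eq_abs, abs_of_pos htpow]
  have h2 : |Real.exp (-t) / ((q.totient : ℝ) * t)| ≤ t ^ (-(2 : ℝ)) := by
    rw [abs_of_nonneg (by positivity), div_le_iff₀ (by positivity)]
    have he : Real.exp (-t) ≤ 1 := Real.exp_le_one_iff.mpr (by linarith [ht.1])
    have ht2 : 1 ≤ t ^ (-(2 : ℝ)) * t := by
      rw [show t ^ (-(2 : ℝ)) * t = t ^ (-(1 : ℝ)) by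
        rw [← Real.rpow_add_one ht.1.ne']; norm_num, Real.rpow_neg_one]
      exact one_le_inv_iff₀.mpr ⟨ht.1, ht.2.le⟩
    nlinarith
  calc |laplaceSeries (residueClass a) t - Real.exp (-t) / ((q.totient : ℝ) * t)|
      ≤ |laplaceSeries (residueClass a) t| + |Real.exp (-t) / ((q.totient : ℝ) * t)| :=
        abs_sub _ _
    _ ≤ geomWeightConst 1 * t ^ (-(2 : ℝ)) + t ^ (-(2 : ℝ)) := by
        rw [abs_of_nonneg h0]; exact add_le_add hle h2
    _ = (geomWeightConst 1 + 1) * t ^ (-(2 : ℝ)) := by ring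

/-- The Mellin transform of `E_a` is holomorphic on `Re s > σ₀` as soon as `E_a(t) = O(t^{-σ₀})`
at `0⁺`. [folklore] -/
theorem differentiableAt_mellin_errLaplace (a : ZMod q) {σ₀ : ℝ}
    (hO : (fun t : ℝ ↦ ((laplaceSeries (residueClass a) t -
      Real.exp (-t) / ((q.totient : ℝ) * t) : ℝ) : ℂ)) =O[𝓝[>] 0] fun t ↦ t ^ (-σ₀))
    {s : ℂ} (hs : σ₀ < s.re) :
    DifferentiableAt ℂ (mellin fun t : ℝ ↦ ((laplaceSeries (residueClass a) t -
      Real.exp (-t) / ((q.totient : ℝ) * t) : ℝ) : ℂ)) s :=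
  mellin_differentiableAt_of_isBigO_rpow_exp one_pos
    ((Complex.continuous_ofReal.comp_continuousOn (continuousOn_errLaplace a))
      |>.locallyIntegrableOn measurableSet_Ioi) (errLaplace_isBigO_exp_atTop a) hO hs

/-- `E_a` is Mellin-convergent on `Re s > 2`. [folklore] -/
theorem mellinConvergent_errLaplace (a : ZMod q) {s : ℂ} (hs : 2 < s.re) :
    MellinConvergent (fun t : ℝ ↦ ((laplaceSeries (residueClass a) t -
      Real.exp (-t) / ((q.totient : ℝ) * t) : ℝ) : ℂ)) s :=
  mellinConvergent_of_isBigO_rpow_exp one_pos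
    ((Complex.continuous_ofReal.comp_continuousOn (continuousOn_errLaplace a))
      |>.locallyIntegrableOn measurableSet_Ioi) (errLaplace_isBigO_exp_atTop a)
    (errLaplace_isBigO_nhdsGT_two a) hs

/-- The Mellin transform of `t ↦ e^{-t}/(φ t)` at `Re s > 1` is `Γ(s)/(φ (s − 1))`
(Euler's integral for `Γ(s − 1)`). [folklore] -/
theorem hasMellin_exp_neg_div (φ : ℝ) {s : ℂ} (hs : 1 < s.re) :
    HasMellin (fun t : ℝ ↦ ((Real.exp (-t) / (φ * t) : ℝ) : ℂ)) s
      (Complex.Gamma s / (φ * (s - 1))) := by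
  have hs1 : 0 < (s - 1).re := by simp; linarith
  have hs1' : s - 1 ≠ 0 := fun h ↦ by rw [h] at hs1; simp at hs1
  -- pointwise form of the integrand on `(0, ∞)`
  have hpt : ∀ t ∈ Ioi (0 : ℝ), (t : ℂ) ^ (s - 1) • ((Real.exp (-t) / (φ * t) : ℝ) : ℂ) =
      (φ : ℂ)⁻¹ * ((Real.exp (-t) : ℂ) * (t : ℂ) ^ (s - 1 - 1)) := by
    intro t ht
    have ht : (0 : ℝ) < t := ht
    have ht' : (t : ℂ) ≠ 0 := Complex.ofReal_ne_zero.mpr ht.ne'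
    conv_rhs => rw [Complex.cpow_sub _ _ ht', Complex.cpow_one]
    rw [smul_eq_mul]
    push_cast
    field_simp
  have hconv := Complex.GammaIntegral_convergent hs1
  have hint : IntegrableOn (fun t : ℝ ↦ (φ : ℂ)⁻¹ * ((Real.exp (-t) : ℂ) * (t : ℂ) ^ (s - 1 - 1)))
      (Ioi 0) := by
    refine Integrable.const_mul (hconv.congr_fun (fun t _ ↦ ?_) measurableSet_Ioi) _
    simp
  constructor
  · exact (hint.congr_fun (fun t ht ↦ (hpt t ht).symm) measurableSet_Ioi)
  · rw [mellin, setIntegral_congr_fun measurableSet_Ioi hpt, integral_const_mul]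
    have hG : ∫ t in Ioi (0 : ℝ), (Real.exp (-t) : ℂ) * (t : ℂ) ^ (s - 1 - 1) =
        Complex.Gamma (s - 1) := by
      rw [Complex.Gamma_eq_integral hs1, Complex.GammaIntegral]
    rw [hG]
    have hΓ : Complex.Gamma s = (s - 1) * Complex.Gamma (s - 1) := by
      rw [← Complex.Gamma_add_one _ hs1', sub_add_cancel]
    rw [hΓ]
    field_simp

omit [NeZero q] in
/-- For `Re s > 1`, `∑ |Λ_a(n)| n^{-Re s} < ∞`. [folklore] -/
theorem summable_abs_residueClass_div_rpow (a : ZMod q) {s : ℂ} (hs : 1 < s.re) :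
    Summable fun n : ℕ ↦ |residueClass a n| / (n : ℝ) ^ s.re := by
  have hΛ := ArithmeticFunction.LSeriesSummable_vonMangoldt hs
  rw [LSeriesSummable, ← summable_norm_iff] at hΛ
  refine Summable.of_nonneg_of_le (fun n ↦ by positivity) (fun n ↦ ?_) hΛ
  rw [LSeries.norm_term_eq]
  rcases eq_or_ne n 0 with rfl | hn
  · simp [residueClass_apply_zero]
  · rw [if_neg hn, Complex.norm_real, Real.norm_eq_abs,
      abs_of_nonneg ArithmeticFunction.vonMangoldt_nonneg]
    refine div_le_div_of_nonneg_right ?_ (by positivity)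
    rw [abs_of_nonneg (residueClass_nonneg a n)]
    exact residueClass_le a n

/-- **Mellin transform of `E_a`.** For `Re s > 2` (and an invertible residue `a`),
`∫₀^∞ E_a(t) t^{s−1} dt = Γ(s) · (L(Λ_a, s) − φ(q)⁻¹/(s − 1))`, i.e. `Γ(s)` times Mathlib's
`LFunctionResidueClassAux a s` (the `L`-series of `Λ` on the class `a` with the principal part
at `s = 1` removed). [folklore] -/
theorem mellin_errLaplace {a : ZMod q} (ha : IsUnit a) {s : ℂ} (hs : 2 < s.re) :
    mellin (fun t : ℝ ↦ ((laplaceSeries (residueClass a) t -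
      Real.exp (-t) / ((q.totient : ℝ) * t) : ℝ) : ℂ)) s =
      Complex.Gamma s * LFunctionResidueClassAux a s := by
  have hs1 : 1 < s.re := by linarith
  have hs0 : 0 < s.re := by linarith
  set E := fun t : ℝ ↦ ((laplaceSeries (residueClass a) t -
    Real.exp (-t) / ((q.totient : ℝ) * t) : ℝ) : ℂ) with hEdef
  set P := fun t : ℝ ↦ ((Real.exp (-t) / ((q.totient : ℝ) * t) : ℝ) : ℂ) with hPdef
  have hE : MellinConvergent E s := mellinConvergent_errLaplace a hs
  obtain ⟨hP, hPm⟩ := hasMellin_exp_neg_div (q.totient : ℝ) hs1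
  have hsum := hasMellin_add hE hP
  have hfun : (fun t ↦ E t + P t) = fun t ↦ ((laplaceSeries (residueClass a) t : ℝ) : ℂ) := by
    funext t; simp only [hEdef, hPdef]; push_cast; ring
  rw [hfun] at hsum
  have hL := mellin_laplaceSeries (b := residueClass a) (residueClass_apply_zero a) hs0
    (summable_abs_residueClass_div_rpow a hs1)
  have h1 : mellin E s = Complex.Gamma s * LSeries (fun n ↦ (residueClass a n : ℂ)) s -
      Complex.Gamma s / ((q.totient : ℝ) * (s - 1)) := by
    rw [← hL, hsum.2, hPm]; ring
  rw [h1, eqOn_LFunctionResidueClassAux ha (show s ∈ {s : ℂ | 1 < s.re} from hs1)]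
  have hs1' : s - 1 ≠ 0 := fun h ↦ by
    have : (s - 1).re = 0 := by rw [h]; simp
    simp at this; linarith
  have hφ : ((q.totient : ℝ) : ℂ) ≠ 0 := by
    exact_mod_cast (Nat.totient_pos.mpr (NeZero.pos q)).ne'
  push_cast at hφ ⊢
  field_simp

/-- The same Mellin transform, written as a combination of logarithmic derivatives: for
`Re s > 2`, `∫₀^∞ E_a(t) t^{s−1} dt = Γ(s)(−∑_χ φ(q)⁻¹ χ(a)⁻¹ L'(s,χ)/L(s,χ) − φ(q)⁻¹/(s−1))`
(orthogonality, Mathlib `LSeries_residueClass_eq`). [folklore] -/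
theorem mellin_errLaplace_eq_sum {a : ZMod q} (ha : IsUnit a) {s : ℂ} (hs : 2 < s.re) :
    mellin (fun t : ℝ ↦ ((laplaceSeries (residueClass a) t -
      Real.exp (-t) / ((q.totient : ℝ) * t) : ℝ) : ℂ)) s =
      Complex.Gamma s * (-(∑ χ : DirichletCharacter ℂ q, ((q.totient : ℂ)⁻¹ * χ a⁻¹) *
        (deriv χ.LFunction s / χ.LFunction s)) - (q.totient : ℂ)⁻¹ / (s - 1)) := by
  have hs1 : 1 < s.re := by linarith
  rw [mellin_errLaplace ha hs,
    eqOn_LFunctionResidueClassAux ha (show s ∈ {s : ℂ | 1 < s.re} from hs1)]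
  simp only [LSeries_residueClass_eq ha hs1, neg_mul, Finset.mul_sum, mul_assoc,
    Finset.sum_neg_distrib]

/-- **The Landau step for `E_a + E_b`.** Assume DZC mod `q`, let `a, b` be invertible residues
and suppose `E_a(t) + E_b(t) = O(t^{-θ})` as `t → 0⁺` for some `θ > 0`. Then every zero `ρ` of
some `L(·, χ₁)` with `θ < Re ρ < 1`, `ρ ≠ 1/2`, satisfies `χ₁(a)⁻¹ + χ₁(b)⁻¹ = 0`: the Mellin
transform of `E_a + E_b` is holomorphic on `Re s > θ` and equals
`Γ(s)(−φ⁻¹∑_χ (χ(a)⁻¹ + χ(b)⁻¹) L'/L(s,χ) − 2φ⁻¹/(s−1))` on `Re s > 2`, so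
`coeff_eq_zero_of_LFunction_eq_zero` applies. (Bhowmik–Halupczok–Matsumoto–Suzuki obtain the
corresponding statement from the explicit formula for `S(x; q, a, b)`, Proposition 3: "this
residue is non-zero so that `ρ_q + 1` is a pole of `F(s)`".)
[cite: BhowmikHalupczokMatsumotoSuzuki2019, Proposition 3 and proof of Theorem 1 (2)] -/
theorem apply_inv_add_apply_inv_eq_zero
    (hDZC : ∀ χ₁ χ₂ : DirichletCharacter ℂ q, χ₁ ≠ χ₂ →
      ∀ s : ℂ, 0 < s.re → s.re < 1 → s ≠ 1 / 2 → ¬ (χ₁.LFunction s = 0 ∧ χ₂.LFunction s = 0))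
    {a b : ZMod q} (ha : IsUnit a) (hb : IsUnit b) {θ : ℝ} (hθ : 0 < θ)
    (hO : (fun t : ℝ ↦ ((laplaceSeries (residueClass a) t - Real.exp (-t) / ((q.totient : ℝ) * t) +
      (laplaceSeries (residueClass b) t - Real.exp (-t) / ((q.totient : ℝ) * t)) : ℝ) : ℂ))
      =O[𝓝[>] 0] fun t ↦ t ^ (-θ))
    {χ₁ : DirichletCharacter ℂ q} {ρ : ℂ} (hρ : χ₁.LFunction ρ = 0) (h1 : θ < ρ.re)
    (h2 : ρ.re < 1) (h3 : ρ ≠ 1 / 2) : χ₁ a⁻¹ + χ₁ b⁻¹ = 0 := by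
  set Ea := fun t : ℝ ↦ ((laplaceSeries (residueClass a) t -
    Real.exp (-t) / ((q.totient : ℝ) * t) : ℝ) : ℂ) with hEa
  set Eb := fun t : ℝ ↦ ((laplaceSeries (residueClass b) t -
    Real.exp (-t) / ((q.totient : ℝ) * t) : ℝ) : ℂ) with hEb
  set E := fun t : ℝ ↦ ((laplaceSeries (residueClass a) t - Real.exp (-t) / ((q.totient : ℝ) * t) +
      (laplaceSeries (residueClass b) t - Real.exp (-t) / ((q.totient : ℝ) * t)) : ℝ) : ℂ) with hE
  have hEab : E = fun t ↦ Ea t + Eb t := by funext t; simp only [hE, hEa, hEb]; push_cast; ring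
  -- holomorphy of the Mellin transform on `Re s > θ`
  have hcont : ContinuousOn E (Ioi 0) := by
    rw [hEab]
    exact (Complex.continuous_ofReal.comp_continuousOn (continuousOn_errLaplace a)).add
      (Complex.continuous_ofReal.comp_continuousOn (continuousOn_errLaplace b))
  have htop : E =O[atTop] fun t ↦ Real.exp (-1 * t) := by
    rw [hEab]; exact (errLaplace_isBigO_exp_atTop a).add (errLaplace_isBigO_exp_atTop b)
  have hM : ∀ w : ℂ, θ < w.re → DifferentiableAt ℂ (mellin E) w := fun w hw ↦
    mellin_differentiableAt_of_isBigO_rpow_exp one_pos (hcont.locallyIntegrableOn measurableSet_Ioi)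
      htop hO hw
  -- the identity on `Re s > 2`
  have hφ : (q.totient : ℂ) ≠ 0 := by exact_mod_cast (Nat.totient_pos.mpr (NeZero.pos q)).ne'
  have ha' : IsUnit a⁻¹ := isUnit_of_dvd_one ⟨a, (ZMod.inv_mul_of_unit a ha).symm⟩
  have hb' : IsUnit b⁻¹ := isUnit_of_dvd_one ⟨b, (ZMod.inv_mul_of_unit b hb).symm⟩
  set c : DirichletCharacter ℂ q → ℂ := fun χ ↦ (q.totient : ℂ)⁻¹ * (χ a⁻¹ + χ b⁻¹) with hc
  have hid : ∀ w : ℂ, 2 < w.re → mellin E w = Complex.Gamma w *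
      (-(∑ χ, c χ * (deriv χ.LFunction w / χ.LFunction w)) - c 1 / (w - 1)) := by
    intro w hw
    have hsum := hasMellin_add (mellinConvergent_errLaplace a hw) (mellinConvergent_errLaplace b hw)
    rw [← hEab] at hsum
    rw [hsum.2, mellin_errLaplace_eq_sum ha hw, mellin_errLaplace_eq_sum hb hw]
    simp only [hc, MulChar.one_apply ha', MulChar.one_apply hb', Finset.sum_add_distrib, add_mul,
      mul_add]
    ring
  have key := coeff_eq_zero_of_LFunction_eq_zero hDZC hθ hM c (by norm_num : (1 : ℝ) ≤ 2) hid
    hρ h1 h2 h3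
  simpa [hc, hφ] using key

end ResidueClass

end LaplaceProgressions

end Literature.NumberTheory.LFunctions

end
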